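import Mathlib
import Summits.NavierStokesRegularity.NavierStokesRegularity.Theorems.WakeRatchetTailRatchetRelayProfile
import Summits.NavierStokesRegularity.NavierStokesRegularity.Theorems.WakeRatchetTailRatchetRelayGreen
import HarnessLib

/-!
# `WakeRatchet.TailRatchet` (stmt-NavierStokesRegularity-21808): MOMENTS of the adjoint mode — Euler's
# identities `Σ_m c_m = 0` and `Σ_m c_m 2^{−m} = 0` from Green's identity

Support file for the crux `TailRatchet` (route `WakeRatchet`; MODEL lattice ODEs of Tao 2016 §1.2, §4 —
nothing in this file is a statement about the Navier–Stokes equations, and no item is closed here).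

Context (files `…RelayProfile` / `…RelayAdjoint` / `…RelayTransversality` / `…RelayKernel` / `…RelayGreen`;
census of stmt-21808, programme "R-lac"): `w₁(t) = Σ_m c_m e^{(2^m−1)t}`, `c_m = ∏_{i<m}(−4)/(2^{i+1}−1)`,
is the adjoint mode of the linearised drain-free scalar front operator `L₀h = h' − 2e^{t/2}h(t/2)` at the
relay profile.  Green's identity (`WakeRatchetRelayGreen.adjoint_green`) tested against the two explicit
elements `h = (1+t)e^{t}` (kernel of `L₀`) and `h = e^{t}` (the profile itself, `L₀e^{t} = −e^{t}`) yields,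
sorry-free, two `q`-series identities that on paper are instances of Euler's `q`-exponential theorem at
`q = ½` (`Σ_m (−4q)^m q^{m(m−1)/2}/(q;q)_m·… `):

* `adjoint_at_zero` — **`w₁(0) = 0`**, i.e. `tsum_coeff_eq_zero`: `Σ_m c_m = 0`
  (`= ∏_{i≥1}(1 − 4·2^{−i})`, whose `i = 2` factor vanishes);
* `integral_adjoint_exp` — **`∫_{(−∞,0]} w₁(t)e^{t} dt = 0`**, i.e. `tsum_coeff_div_two_pow_eq_zero`:
  `Σ_m c_m 2^{−m} = 0` (`= ∏_{i≥0}(1 − 2^{−i})`);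
* hence `transversality_eq_half_moment` — the transversality number is the pure first moment
  `τ = ½ ∫_{(−∞,0]} w₁(t)·t·e^{t} dt` (`= −½∏_{i≥1}(1−2^{−i})` on paper).

READING: `w₁(0) = 0` says the solvability functional `f ↦ ∫w₁f` of the bordered problem does not see the
value `h(0)` — consistent with normalising the kernel direction by `h(0) = 0` (`…RelayKernel`).

HONEST FRAMING: elementary real analysis; MODEL lattice only; the construction item and the crux stay open.
-/

noncomputable section

set_option linter.dupNamespace false

namespace Summit.NavierStokesRegularity.NavierStokesRegularity.Theorems

namespace WakeRatchetRelayMoments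

open MeasureTheory Set Filter Topology Real
open WakeRatchetRelayProfile WakeRatchetRelayAdjoint WakeRatchetRelayTransversality WakeRatchetRelayGreen

/-! ## Two test functions for Green's identity -/

/-- `(1+t)e^{t} → 0` as `t → −∞`. [folklore] -/
theorem tendsto_kernel_atBot : Tendsto (fun t : ℝ => (1 + t) * Real.exp t) atBot (𝓝 0) := by
  have hb : ∀ t : ℝ, t ≤ 0 → ‖(1 + t) * Real.exp t‖ ≤ Real.exp t + 2 * Real.exp (1 / 2 * t) := by
    intro t ht
    have h1 := abs_mul_exp_le one_pos ht
    rw [Real.norm_eq_abs, abs_mul, abs_of_pos (Real.exp_pos _)]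
    calc |1 + t| * Real.exp t ≤ (|1| + |t|) * Real.exp t :=
          mul_le_mul_of_nonneg_right (abs_add_le _ _) (Real.exp_pos _).le
      _ = Real.exp t + |t| * Real.exp (1 * t) := by rw [abs_one, one_mul]; ring
      _ ≤ Real.exp t + 2 / 1 * Real.exp (1 / 2 * t) := by linarith
      _ = Real.exp t + 2 * Real.exp (1 / 2 * t) := by ring
  have hlim : Tendsto (fun t : ℝ => Real.exp t + 2 * Real.exp (1 / 2 * t)) atBot (𝓝 0) := by
    have h1 : Tendsto (fun t : ℝ => Real.exp (1 / 2 * t)) atBot (𝓝 0) :=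
      Real.tendsto_exp_atBot.comp (tendsto_id.const_mul_atBot (by norm_num : (0 : ℝ) < 1 / 2))
    simpa using Real.tendsto_exp_atBot.add (h1.const_mul 2)
  exact squeeze_zero_norm' (eventually_atBot.2 ⟨0, hb⟩) hlim

/-- `|(1+t)e^{t}| ≤ 3` on `t ≤ 0`. [folklore] -/
theorem kernel_abs_le {t : ℝ} (ht : t ≤ 0) : |(1 + t) * Real.exp t| ≤ 3 := by
  have h1 := abs_mul_exp_le one_pos ht
  have h2 : Real.exp t ≤ 1 := Real.exp_le_one_iff.2 ht
  have h3 : Real.exp (1 / 2 * t) ≤ 1 := Real.exp_le_one_iff.2 (by linarith)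
  rw [abs_mul, abs_of_pos (Real.exp_pos _)]
  calc |1 + t| * Real.exp t ≤ (|1| + |t|) * Real.exp t :=
        mul_le_mul_of_nonneg_right (abs_add_le _ _) (Real.exp_pos _).le
    _ = Real.exp t + |t| * Real.exp (1 * t) := by rw [abs_one, one_mul]; ring
    _ ≤ 1 + 2 / 1 * Real.exp (1 / 2 * t) := by linarith
    _ ≤ 3 := by linarith

/-- The derivative `(2+t)e^{t}` of the kernel element is integrable on `(−∞,0]`. [folklore] -/
theorem integrableOn_kernel_deriv :
    IntegrableOn (fun t : ℝ => 2 * Real.exp (t / 2) * ((1 + t / 2) * Real.exp (t / 2))) (Iic 0) := by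
  have h : (fun t : ℝ => 2 * Real.exp (t / 2) * ((1 + t / 2) * Real.exp (t / 2))) =
      fun t : ℝ => 2 * Real.exp (1 * t) + t * Real.exp (1 * t) := by
    funext t
    have : Real.exp (t / 2) * Real.exp (t / 2) = Real.exp (1 * t) := by
      rw [← Real.exp_add]; ring_nf
    calc 2 * Real.exp (t / 2) * ((1 + t / 2) * Real.exp (t / 2))
        = (2 + t) * (Real.exp (t / 2) * Real.exp (t / 2)) := by ring
      _ = 2 * Real.exp (1 * t) + t * Real.exp (1 * t) := by rw [this]; ring
  rw [h]
  exact ((integrableOn_exp_mul_Iic one_pos 0).const_mul 2).add (integrableOn_mul_exp_mul_Iic one_pos)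

/-! ## `w₁(0) = 0` -/

/-- **`w₁(0) = 0`.**  Green's identity against the kernel element `h = (1+t)e^{t}` (`L₀h = 0`, `h(0) = 1`,
`h(−∞) = 0`) gives `0 = w₁(0)·1 − 0`.
[cite: Tao2016AveragedNS, §1.2 (dyadic model); cell vocabulary (adjoint mode of the linearised scalar front equation of `DyadicScalarFronts` at the relay profile; programme R-lac)] -/
theorem adjoint_at_zero :
    (∑' m : ℕ, (∏ i ∈ Finset.range m, ((-4 : ℝ) / (2 ^ (i + 1) - 1))) *
      Real.exp ((2 ^ m - 1) * (0 : ℝ))) = 0 := by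
  set W : ℝ → ℝ := fun t : ℝ => ∑' m : ℕ,
      (∏ i ∈ Finset.range m, ((-4 : ℝ) / (2 ^ (i + 1) - 1))) * Real.exp ((2 ^ m - 1) * t) with hW
  have hG := adjoint_green W hW (h := fun t : ℝ => (1 + t) * Real.exp t)
    (h' := fun t : ℝ => 2 * Real.exp (t / 2) * ((1 + t / 2) * Real.exp (t / 2))) (B := 3) (L := 0)
    (by fun_prop) (fun t _ => relay_kernel_hasDerivAt t) (fun t ht => kernel_abs_le ht)
    integrableOn_kernel_deriv tendsto_kernel_atBot
  have hzero : (fun t : ℝ => W t * ((fun t : ℝ => 2 * Real.exp (t / 2) * ((1 + t / 2) * Real.exp (t / 2))) t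
      - 2 * Real.exp (t / 2) * (fun t : ℝ => (1 + t) * Real.exp t) (t / 2))) = fun _ => 0 := by
    funext t; ring
  rw [hzero, integral_zero] at hG
  have h1 : W 0 = 0 := by
    have : W 0 * ((1 + 0) * Real.exp 0) - 0 = 0 := hG.symm
    simpa using this
  simpa [hW] using h1

/-- **Euler's identity `Σ_m c_m = 0`** (`c_m = ∏_{i<m}(−4)/(2^{i+1}−1)`; on paper `= ∏_{i≥1}(1−4·2^{−i})`).
[folklore] -/
theorem tsum_coeff_eq_zero :
    (∑' m : ℕ, ∏ i ∈ Finset.range m, ((-4 : ℝ) / (2 ^ (i + 1) - 1))) = 0 := by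
  have h := adjoint_at_zero
  simp only [mul_zero, Real.exp_zero, mul_one] at h
  exact h

/-! ## `∫ w₁ e^{t} = 0` -/

/-- **`∫_{(−∞,0]} w₁(t) e^{t} dt = 0`.**  Green's identity against the profile `h = e^{t}` (`L₀e^{t} = −e^{t}`,
`h(0) = 1`, `h(−∞) = 0`) together with `w₁(0) = 0`.
[cite: Tao2016AveragedNS, §1.2 (dyadic model); cell vocabulary (adjoint mode; programme R-lac)] -/
theorem integral_adjoint_exp :
    ∫ t in Iic (0 : ℝ), (∑' m : ℕ, (∏ i ∈ Finset.range m, ((-4 : ℝ) / (2 ^ (i + 1) - 1))) *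
      Real.exp ((2 ^ m - 1) * t)) * Real.exp t = 0 := by
  set W : ℝ → ℝ := fun t : ℝ => ∑' m : ℕ,
      (∏ i ∈ Finset.range m, ((-4 : ℝ) / (2 ^ (i + 1) - 1))) * Real.exp ((2 ^ m - 1) * t) with hW
  have hG := adjoint_green W hW (h := fun t : ℝ => Real.exp t) (h' := fun t : ℝ => Real.exp t)
    (B := 1) (L := 0) Real.continuous_exp.continuousOn (fun t _ => Real.hasDerivAt_exp t)
    (fun t ht => by rw [abs_of_pos (Real.exp_pos t)]; exact Real.exp_le_one_iff.2 ht)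
    (integrableOn_exp_Iic 0) Real.tendsto_exp_atBot
  have hW0 : W 0 = 0 := adjoint_at_zero
  rw [hW0, zero_mul, zero_sub] at hG
  have hfun : (fun t : ℝ => W t * ((fun t : ℝ => Real.exp t) t
      - 2 * Real.exp (t / 2) * (fun t : ℝ => Real.exp t) (t / 2))) = fun t : ℝ => -(W t * Real.exp t) := by
    funext t
    have : Real.exp (t / 2) * Real.exp (t / 2) = Real.exp t := by rw [← Real.exp_add]; ring_nf
    simp only []
    calc W t * (Real.exp t - 2 * Real.exp (t / 2) * Real.exp (t / 2))
        = W t * (Real.exp t - 2 * (Real.exp (t / 2) * Real.exp (t / 2))) := by ring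
      _ = -(W t * Real.exp t) := by rw [this]; ring
  rw [hfun, integral_neg, neg_zero, neg_eq_zero] at hG
  simpa [hW] using hG

/-- Termwise: `∫_{(−∞,0]} c_m e^{(2^m−1)t} e^{t} dt = c_m 2^{−m}`. [folklore] -/
theorem integral_term_exp (m : ℕ) :
    ∫ t in Iic (0 : ℝ), (∏ i ∈ Finset.range m, ((-4 : ℝ) / (2 ^ (i + 1) - 1))) *
      Real.exp ((2 ^ m - 1) * t) * Real.exp t =
      (∏ i ∈ Finset.range m, ((-4 : ℝ) / (2 ^ (i + 1) - 1))) * (1 / 2 ^ m) := by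
  have h : (fun t : ℝ => (∏ i ∈ Finset.range m, ((-4 : ℝ) / (2 ^ (i + 1) - 1))) *
      Real.exp ((2 ^ m - 1) * t) * Real.exp t) = fun t : ℝ =>
      (∏ i ∈ Finset.range m, ((-4 : ℝ) / (2 ^ (i + 1) - 1))) * Real.exp (2 ^ m * t) := by
    funext t
    have : Real.exp ((2 ^ m - 1) * t) * Real.exp t = Real.exp (2 ^ m * t) := by
      rw [← Real.exp_add]; congr 1; ring
    rw [mul_assoc, this]
  rw [h, integral_const_mul, integral_exp_mul_Iic_zero (lt_of_lt_of_le one_pos (one_le_two_pow_real m))]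

/-- Termwise norm: `∫ ‖c_m e^{(2^m−1)t}e^{t}‖ ≤ 210·4^{−m}`. [folklore] -/
theorem integral_term_exp_norm_le (m : ℕ) :
    ∫ t in Iic (0 : ℝ), ‖(∏ i ∈ Finset.range m, ((-4 : ℝ) / (2 ^ (i + 1) - 1))) *
      Real.exp ((2 ^ m - 1) * t) * Real.exp t‖ ≤ 210 / 4 ^ m := by
  have hk : (0 : ℝ) < 2 ^ m := lt_of_lt_of_le one_pos (one_le_two_pow_real m)
  have h : (fun t : ℝ => ‖(∏ i ∈ Finset.range m, ((-4 : ℝ) / (2 ^ (i + 1) - 1))) *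
      Real.exp ((2 ^ m - 1) * t) * Real.exp t‖) = fun t : ℝ =>
      |∏ i ∈ Finset.range m, ((-4 : ℝ) / (2 ^ (i + 1) - 1))| * Real.exp (2 ^ m * t) := by
    funext t
    have : Real.exp ((2 ^ m - 1) * t) * Real.exp t = Real.exp (2 ^ m * t) := by
      rw [← Real.exp_add]; congr 1; ring
    rw [mul_assoc, this, norm_mul, Real.norm_eq_abs, Real.norm_eq_abs, abs_of_pos (Real.exp_pos _)]
  rw [h, integral_const_mul, integral_exp_mul_Iic_zero hk]
  have h1 : 1 / (2 : ℝ) ^ m ≤ 1 := by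
    rw [div_le_iff₀ hk]; linarith [one_le_two_pow_real m]
  calc |∏ i ∈ Finset.range m, ((-4 : ℝ) / (2 ^ (i + 1) - 1))| * (1 / 2 ^ m)
      ≤ 210 / 4 ^ m * 1 := mul_le_mul (coeff_abs_le m) h1 (by positivity) (by positivity)
    _ = 210 / 4 ^ m := mul_one _

/-- **Euler's identity `Σ_m c_m 2^{−m} = 0`** (on paper `= ∏_{i≥0}(1 − 2^{−i})`), read off from
`∫ w₁ e^{t} = 0` by termwise integration. [folklore] -/
theorem tsum_coeff_div_two_pow_eq_zero :
    (∑' m : ℕ, (∏ i ∈ Finset.range m, ((-4 : ℝ) / (2 ^ (i + 1) - 1))) * (1 / 2 ^ m)) = 0 := by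
  have hint : ∀ m : ℕ, IntegrableOn (fun t : ℝ => (∏ i ∈ Finset.range m, ((-4 : ℝ) / (2 ^ (i + 1) - 1))) *
      Real.exp ((2 ^ m - 1) * t) * Real.exp t) (Iic 0) := by
    intro m
    have h : (fun t : ℝ => (∏ i ∈ Finset.range m, ((-4 : ℝ) / (2 ^ (i + 1) - 1))) *
        Real.exp ((2 ^ m - 1) * t) * Real.exp t) = fun t : ℝ =>
        (∏ i ∈ Finset.range m, ((-4 : ℝ) / (2 ^ (i + 1) - 1))) * Real.exp (2 ^ m * t) := by
      funext t
      have : Real.exp ((2 ^ m - 1) * t) * Real.exp t = Real.exp (2 ^ m * t) := by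
        rw [← Real.exp_add]; congr 1; ring
      rw [mul_assoc, this]
    rw [h]
    exact (integrableOn_exp_mul_Iic (lt_of_lt_of_le one_pos (one_le_two_pow_real m)) 0).const_mul _
  have hsum : Summable (fun m : ℕ => ∫ t in Iic (0 : ℝ),
      ‖(∏ i ∈ Finset.range m, ((-4 : ℝ) / (2 ^ (i + 1) - 1))) * Real.exp ((2 ^ m - 1) * t) * Real.exp t‖) :=
    Summable.of_nonneg_of_le (fun m => integral_nonneg fun t => norm_nonneg _)
      integral_term_exp_norm_le summable_majorant
  have key := integral_tsum_of_summable_integral_norm hint hsum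
  simp_rw [integral_term_exp] at key
  rw [key]
  have hfun : (fun t : ℝ => ∑' m : ℕ, (∏ i ∈ Finset.range m, ((-4 : ℝ) / (2 ^ (i + 1) - 1))) *
      Real.exp ((2 ^ m - 1) * t) * Real.exp t) = fun t : ℝ => (∑' m : ℕ,
      (∏ i ∈ Finset.range m, ((-4 : ℝ) / (2 ^ (i + 1) - 1))) * Real.exp ((2 ^ m - 1) * t)) * Real.exp t := by
    funext t; rw [tsum_mul_right]
  rw [hfun]
  exact integral_adjoint_exp

/-! ## The transversality number is the first moment -/

/-- **`τ = ½ ∫_{(−∞,0]} w₁(t)·t·e^{t} dt`**: with `∫ w₁e^{t} = 0`, the transversality number of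
`WakeRatchetRelayTransversality` is the pure first moment of the adjoint mode against `e^{t}`
(on paper `−½∏_{i≥1}(1−2^{−i}) ≈ −0.1444`). [folklore] -/
theorem transversality_eq_half_moment :
    ∫ t in Iic (0 : ℝ), (∑' m : ℕ, (∏ i ∈ Finset.range m, ((-4 : ℝ) / (2 ^ (i + 1) - 1))) *
        Real.exp ((2 ^ m - 1) * t)) * ((1 + t / 2) * Real.exp t) =
      1 / 2 * ∫ t in Iic (0 : ℝ), (∑' m : ℕ, (∏ i ∈ Finset.range m, ((-4 : ℝ) / (2 ^ (i + 1) - 1))) *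
        Real.exp ((2 ^ m - 1) * t)) * (t * Real.exp t) := by
  set W : ℝ → ℝ := fun t : ℝ => ∑' m : ℕ,
      (∏ i ∈ Finset.range m, ((-4 : ℝ) / (2 ^ (i + 1) - 1))) * Real.exp ((2 ^ m - 1) * t) with hW
  have hWcont : ContinuousOn W (Iic 0) := adjoint_continuousOn
  have hWbd : ∀ t : ℝ, t ≤ 0 → |W t| ≤ 71 := fun t ht => adjoint_abs_le ht
  have hWae : ∀ᵐ t ∂(volume.restrict (Iic (0 : ℝ))), ‖W t‖ ≤ 71 :=
    (ae_restrict_iff' measurableSet_Iic).2 (Eventually.of_forall fun t ht => by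
      rw [Real.norm_eq_abs]; exact hWbd t ht)
  have hI1 : IntegrableOn (fun t : ℝ => W t * Real.exp t) (Iic 0) :=
    Integrable.bdd_mul (c := 71) (integrableOn_exp_Iic 0) (hWcont.aestronglyMeasurable measurableSet_Iic) hWae
  have hI2 : IntegrableOn (fun t : ℝ => W t * (t * Real.exp t)) (Iic 0) := by
    have h := integrableOn_mul_exp_mul_Iic (k := 1) one_pos
    simp only [one_mul] at h
    exact Integrable.bdd_mul (c := 71) h (hWcont.aestronglyMeasurable measurableSet_Iic) hWae
  have hsplit : (fun t : ℝ => W t * ((1 + t / 2) * Real.exp t)) =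
      fun t : ℝ => W t * Real.exp t + 1 / 2 * (W t * (t * Real.exp t)) := by
    funext t; ring
  have h0 : ∫ t in Iic (0 : ℝ), W t * Real.exp t = 0 := integral_adjoint_exp
  show ∫ t in Iic (0 : ℝ), W t * ((1 + t / 2) * Real.exp t) = 1 / 2 * ∫ t in Iic (0 : ℝ), W t * (t * Real.exp t)
  rw [hsplit, integral_add hI1 (hI2.const_mul _), integral_const_mul, h0, zero_add]

end WakeRatchetRelayMoments

end Summit.NavierStokesRegularity.NavierStokesRegularity.Theorems

end
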